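import Literature.Geometry.Manifold.SubanalyticSets
import Mathlib.Geometry.Manifold.ContMDiff.NormedSpace
import HarnessLib

/-!
# Semi-analytic and subanalytic subsets of a real-analytic manifold

Topic `Geometry/Manifold`; sequel to `SubanalyticSets.lean` (Hironaka 1975, Def. 3.1 / Def. 3.3 for
subsets of `ℝⁿ`, through the germ scheme `IsLocallyInBooleanClosure`). Buchner 1977 (the programme
towards `Literature.Geometry.Riemannian.buchner1977_cutLocus_triangulable`) speaks of semi-analytic
and subanalytic subsets of a compact real-ANALYTIC MANIFOLD `M` ("`B_t ×_M B_t` is a relatively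
compact semianalytic subset of `B_s ×_M B_s`", p. 119; "the cut locus itself is subanalytic",
p. 121), Hironaka's definitions being local and invariant under analytic isomorphisms
(Hironaka 1973, *Subanalytic sets*, §1; Bierstone–Milman 1988, Def. 2.1 and §3: "Let `M` be a
real analytic manifold. A subset `X` of `M` is semianalytic if each point of `M` has a neighbourhood
`U` such that `X ∩ U` is a finite Boolean combination of sets `{f = 0}`, `{f > 0}`, `f` analytic on
`U`"). This file transports the two definitions VERBATIM to a manifold `M` modelled on
`I : ModelWithCorners ℝ E H` (intended: `IsManifold I ω M`), replacing "`f` real-analytic on `U`" by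
Mathlib's `ContMDiffOn I 𝓘(ℝ, ℝ) ω f U` and "`f : ℝᵐ → ℝⁿ` real-analytic" by
`ContMDiff 𝓘(ℝ, ℝᵐ) I ω f`:

* `manifoldSemianalyticGen I U`, `IsManifoldSemianalytic I A` — Hironaka Def. 3.1 / B–M Def. 2.1 on
  `M`;
* `manifoldSubanalyticGen I U`, `IsManifoldSubanalytic I A` — Hironaka Def. 3.3 on `M`
  (generators: images `f(B)` of bounded semi-analytic `B ⊆ ℝᵐ` under analytic `f : ℝᵐ → M`);
* Boolean closure API for both (from `IsLocallyInBooleanClosure`), sign/zero sets of analytic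
  functions, images of bounded semi-analytic sets;
* **consistency with the vector-space definitions**: on a real normed space `E` with its model
  `𝓘(ℝ, E)`, `IsManifoldSemianalytic 𝓘(ℝ, E) A ↔ IsSemianalytic A` and
  `IsManifoldSubanalytic 𝓘(ℝ, E) A ↔ IsSubanalytic A` (`contMDiffOn_iff_contDiffOn`,
  `ContDiffOn ℝ ω ↔ AnalyticOnNhd` on open sets).

No named facts. The deep theorems (Gabrielov, Hironaka Props. I–III, triangulation) are not here.

## References

* [Hironaka1975] H. Hironaka, Triangulations of algebraic sets, PSPM 29 (1975), Def. 3.1, Def. 3.3.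
* [BierstoneMilman1988] E. Bierstone, P. D. Milman, Semianalytic and subanalytic sets, Publ.
  Math. IHÉS 67 (1988), Def. 2.1, Def. 3.1.
* [Buchner1977Simplicial] M. A. Buchner, Proc. AMS 64 (1977), pp. 119–121.
-/

noncomputable section

open Set Function Filter
open scoped Topology Manifold ContDiff

namespace Literature.Geometry.Manifold

section Defs

variable {E : Type*} [NormedAddCommGroup E] [NormedSpace ℝ E] {H : Type*} [TopologicalSpace H]
  (I : ModelWithCorners ℝ E H) {M : Type*} [TopologicalSpace M] [ChartedSpace H M]

/-- Generators of semi-analytic germs on a manifold over the open set `U`: superlevel sets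
`{ξ | 0 ≤ f ξ}` of functions `f : M → ℝ` real-analytic on `U` (`ContMDiffOn I 𝓘(ℝ, ℝ) ω f U`).
[cite: Hironaka1975, Def. 3.1] -/
def manifoldSemianalyticGen (U : Set M) : Set (Set M) :=
  {s | ∃ f : M → ℝ, ContMDiffOn I 𝓘(ℝ, ℝ) ω f U ∧ s = {ξ | 0 ≤ f ξ}}

/-- **Semi-analytic subsets of a real-analytic manifold** (Hironaka 1975, Def. 3.1; Bierstone–Milman
1988, Def. 2.1): the germ of `A` at every point lies in the Boolean class generated by germs of
sets `{ξ ∈ U | f(ξ) ≥ 0}`, `f` analytic on the open neighbourhood `U`.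
[cite: Hironaka1975, Def. 3.1] -/
def IsManifoldSemianalytic (A : Set M) : Prop :=
  IsLocallyInBooleanClosure (manifoldSemianalyticGen I) A

/-- Generators of subanalytic germs on a manifold (over any neighbourhood): images `f '' B` of
bounded semi-analytic `B ⊆ ℝᵐ` under maps `f : ℝᵐ → M` real-analytic on all of `ℝᵐ`
(`ContMDiff 𝓘(ℝ, Fin m → ℝ) I ω f`). [cite: Hironaka1975, Def. 3.3] -/
def manifoldSubanalyticGen (_U : Set M) : Set (Set M) :=
  {s | ∃ (m : ℕ) (B : Set (Fin m → ℝ)) (f : (Fin m → ℝ) → M),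
    IsSemianalytic B ∧ Bornology.IsBounded B ∧ ContMDiff 𝓘(ℝ, Fin m → ℝ) I ω f ∧ s = f '' B}

/-- **Subanalytic subsets of a real-analytic manifold** (Hironaka 1975, Def. 3.3, with `ℝⁿ`
replaced by the manifold `M`): the germ of `A` at every point lies in the Boolean class generated
by germs of sets `f(B)`, `B` bounded semi-analytic in some `ℝᵐ`, `f : ℝᵐ → M` analytic.
[cite: Hironaka1975, Def. 3.3] -/
def IsManifoldSubanalytic (A : Set M) : Prop :=
  IsLocallyInBooleanClosure (manifoldSubanalyticGen I) A

variable {I}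

/-- The semi-analytic generating families are antitone in the neighbourhood. [folklore] -/
theorem manifoldSemianalyticGen_antitone (U V : Set M) (hVU : V ⊆ U) :
    manifoldSemianalyticGen I U ⊆ manifoldSemianalyticGen I V := by
  rintro s ⟨f, hf, rfl⟩
  exact ⟨f, hf.mono hVU, rfl⟩

/-- The subanalytic generating families do not depend on the neighbourhood. [folklore] -/
theorem manifoldSubanalyticGen_antitone (U V : Set M) (_hVU : V ⊆ U) :
    manifoldSubanalyticGen I U ⊆ manifoldSubanalyticGen I V := fun _ hs => hs

/-- Unfolding of `IsManifoldSemianalytic`. [cite: Hironaka1975, Def. 3.1] -/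
theorem isManifoldSemianalytic_iff (A : Set M) : IsManifoldSemianalytic I A ↔
    ∀ x : M, ∃ U : Set M, IsOpen U ∧ x ∈ U ∧ ∃ S : Set (Set M), S.Finite ∧
      (∀ s ∈ S, ∃ f : M → ℝ, ContMDiffOn I 𝓘(ℝ, ℝ) ω f U ∧ s = {ξ | 0 ≤ f ξ}) ∧
        ∃ B ∈ BooleanSubalgebra.closure S, A ∩ U = B ∩ U := Iff.rfl

/-- Unfolding of `IsManifoldSubanalytic`. [cite: Hironaka1975, Def. 3.3] -/
theorem isManifoldSubanalytic_iff (A : Set M) : IsManifoldSubanalytic I A ↔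
    ∀ x : M, ∃ U : Set M, IsOpen U ∧ x ∈ U ∧ ∃ S : Set (Set M), S.Finite ∧
      (∀ s ∈ S, ∃ (m : ℕ) (B : Set (Fin m → ℝ)) (f : (Fin m → ℝ) → M),
        IsSemianalytic B ∧ Bornology.IsBounded B ∧ ContMDiff 𝓘(ℝ, Fin m → ℝ) I ω f ∧ s = f '' B) ∧
        ∃ B ∈ BooleanSubalgebra.closure S, A ∩ U = B ∩ U := Iff.rfl

namespace IsManifoldSemianalytic

variable {A A₁ A₂ : Set M}

/-- Closure under complement. [cite: Hironaka1975, Def. 3.1] -/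
theorem compl (h : IsManifoldSemianalytic I A) : IsManifoldSemianalytic I Aᶜ :=
  IsLocallyInBooleanClosure.compl h

/-- Closure under union. [cite: Hironaka1975, Def. 3.1] -/
theorem union (h₁ : IsManifoldSemianalytic I A₁) (h₂ : IsManifoldSemianalytic I A₂) :
    IsManifoldSemianalytic I (A₁ ∪ A₂) :=
  IsLocallyInBooleanClosure.union manifoldSemianalyticGen_antitone h₁ h₂

/-- Closure under intersection. [cite: Hironaka1975, Def. 3.1] -/
theorem inter (h₁ : IsManifoldSemianalytic I A₁) (h₂ : IsManifoldSemianalytic I A₂) :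
    IsManifoldSemianalytic I (A₁ ∩ A₂) :=
  IsLocallyInBooleanClosure.inter manifoldSemianalyticGen_antitone h₁ h₂

/-- Closure under difference. [folklore] -/
theorem diff (h₁ : IsManifoldSemianalytic I A₁) (h₂ : IsManifoldSemianalytic I A₂) :
    IsManifoldSemianalytic I (A₁ \ A₂) :=
  IsLocallyInBooleanClosure.diff manifoldSemianalyticGen_antitone h₁ h₂

end IsManifoldSemianalytic

namespace IsManifoldSubanalytic

variable {A A₁ A₂ : Set M}

/-- Closure under complement (built into Def. 3.3). [cite: Hironaka1975, Def. 3.3] -/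
theorem compl (h : IsManifoldSubanalytic I A) : IsManifoldSubanalytic I Aᶜ :=
  IsLocallyInBooleanClosure.compl h

/-- Closure under union. [cite: Hironaka1975, Def. 3.3] -/
theorem union (h₁ : IsManifoldSubanalytic I A₁) (h₂ : IsManifoldSubanalytic I A₂) :
    IsManifoldSubanalytic I (A₁ ∪ A₂) :=
  IsLocallyInBooleanClosure.union manifoldSubanalyticGen_antitone h₁ h₂

/-- Closure under intersection. [cite: Hironaka1975, Def. 3.3] -/
theorem inter (h₁ : IsManifoldSubanalytic I A₁) (h₂ : IsManifoldSubanalytic I A₂) :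
    IsManifoldSubanalytic I (A₁ ∩ A₂) :=
  IsLocallyInBooleanClosure.inter manifoldSubanalyticGen_antitone h₁ h₂

/-- Closure under difference. [folklore] -/
theorem diff (h₁ : IsManifoldSubanalytic I A₁) (h₂ : IsManifoldSubanalytic I A₂) :
    IsManifoldSubanalytic I (A₁ \ A₂) :=
  IsLocallyInBooleanClosure.diff manifoldSubanalyticGen_antitone h₁ h₂

end IsManifoldSubanalytic

/-- `univ` and `∅` are semi-analytic and subanalytic on any manifold. [folklore] -/
theorem isManifoldSemianalytic_univ : IsManifoldSemianalytic I (univ : Set M) :=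
  IsLocallyInBooleanClosure.univ

/-- `∅` is semi-analytic. [folklore] -/
theorem isManifoldSemianalytic_empty : IsManifoldSemianalytic I (∅ : Set M) :=
  IsLocallyInBooleanClosure.empty

/-- `univ` is subanalytic. [folklore] -/
theorem isManifoldSubanalytic_univ : IsManifoldSubanalytic I (univ : Set M) :=
  IsLocallyInBooleanClosure.univ

/-- `∅` is subanalytic. [folklore] -/
theorem isManifoldSubanalytic_empty : IsManifoldSubanalytic I (∅ : Set M) :=
  IsLocallyInBooleanClosure.empty

/-- **Superlevel sets of analytic functions on `M` are semi-analytic.** [cite: Hironaka1975, Def. 3.1] -/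
theorem isManifoldSemianalytic_setOf_nonneg {f : M → ℝ} (hf : ContMDiff I 𝓘(ℝ, ℝ) ω f) :
    IsManifoldSemianalytic I {ξ | 0 ≤ f ξ} :=
  IsLocallyInBooleanClosure.of_mem_gen fun x =>
    ⟨univ, isOpen_univ, mem_univ x, f, hf.contMDiffOn, rfl⟩

/-- Strict superlevel sets `{0 < f}` of analytic functions on `M` are semi-analytic. [folklore] -/
theorem isManifoldSemianalytic_setOf_pos {f : M → ℝ} (hf : ContMDiff I 𝓘(ℝ, ℝ) ω f) :
    IsManifoldSemianalytic I {ξ | 0 < f ξ} := by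
  have hneg : ContMDiff I 𝓘(ℝ, ℝ) ω fun ξ => -f ξ := by
    have h := (contDiff_neg (𝕜 := ℝ) (F := ℝ)).comp_contMDiff hf
    exact h
  have h := (isManifoldSemianalytic_setOf_nonneg hneg).compl
  convert h using 1
  ext ξ
  simp

/-- Zero sets `{f = 0}` of analytic functions on `M` are semi-analytic. [cite: Hironaka1975, Rem. 3.2] -/
theorem isManifoldSemianalytic_setOf_eq_zero {f : M → ℝ} (hf : ContMDiff I 𝓘(ℝ, ℝ) ω f) :
    IsManifoldSemianalytic I {ξ | f ξ = 0} := by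
  have hneg : ContMDiff I 𝓘(ℝ, ℝ) ω fun ξ => -f ξ := by
    have h := (contDiff_neg (𝕜 := ℝ) (F := ℝ)).comp_contMDiff hf
    exact h
  have h := (isManifoldSemianalytic_setOf_nonneg hf).inter (isManifoldSemianalytic_setOf_nonneg hneg)
  convert h using 1
  ext ξ
  simp only [mem_setOf_eq, mem_inter_iff, neg_nonneg]
  constructor
  · intro h0
    rw [h0]
    exact ⟨le_rfl, le_rfl⟩
  · rintro ⟨h1, h2⟩
    exact le_antisymm h2 h1

/-- **Images of bounded semi-analytic subsets of `ℝᵐ` under analytic maps into `M` are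
subanalytic.** [cite: Hironaka1975, Def. 3.3] -/
theorem isManifoldSubanalytic_image {m : ℕ} {B : Set (Fin m → ℝ)} (hB : IsSemianalytic B)
    (hBb : Bornology.IsBounded B) {f : (Fin m → ℝ) → M} (hf : ContMDiff 𝓘(ℝ, Fin m → ℝ) I ω f) :
    IsManifoldSubanalytic I (f '' B) :=
  IsLocallyInBooleanClosure.of_mem_gen fun x =>
    ⟨univ, isOpen_univ, mem_univ x, m, B, f, hB, hBb, hf, rfl⟩

end Defs

/-! ### Consistency with the vector-space definitions -/

section Consistency

variable {E : Type*} [NormedAddCommGroup E] [NormedSpace ℝ E]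

/-- Generic congruence: two generating families that agree on open sets define the same class. [folklore] -/
theorem IsLocallyInBooleanClosure.congr_gen {X : Type*} [TopologicalSpace X]
    {gen gen' : Set X → Set (Set X)} (h : ∀ U, IsOpen U → gen U = gen' U) {A : Set X} :
    IsLocallyInBooleanClosure gen A ↔ IsLocallyInBooleanClosure gen' A := by
  constructor
  · intro hA x
    obtain ⟨U, hU, hx, S, hSf, hSg, B, hB, hAB⟩ := hA x
    exact ⟨U, hU, hx, S, hSf, by rwa [← h U hU], B, hB, hAB⟩
  · intro hA x
    obtain ⟨U, hU, hx, S, hSf, hSg, B, hB, hAB⟩ := hA x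
    exact ⟨U, hU, hx, S, hSf, by rwa [h U hU], B, hB, hAB⟩

/-- On an open subset of a real normed space, "`C^ω` in the manifold sense for the model `𝓘(ℝ, E)`"
is "real-analytic". [folklore] -/
theorem contMDiffOn_model_omega_iff_analyticOnNhd {f : E → ℝ} {U : Set E} (hU : IsOpen U) :
    ContMDiffOn 𝓘(ℝ, E) 𝓘(ℝ, ℝ) ω f U ↔ AnalyticOnNhd ℝ f U := by
  rw [contMDiffOn_iff_contDiffOn]
  constructor
  · intro h y hy
    exact ((h y hy).contDiffAt (hU.mem_nhds hy)).analyticAt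
  · intro h y hy
    exact (h y hy).contDiffAt.contDiffWithinAt

/-- **On a real normed space the manifold notion of semi-analytic set is the vector-space one.** [folklore] -/
theorem isManifoldSemianalytic_model_iff {A : Set E} :
    IsManifoldSemianalytic 𝓘(ℝ, E) A ↔ IsSemianalytic A := by
  refine IsLocallyInBooleanClosure.congr_gen fun U hU => ?_
  ext s
  simp only [manifoldSemianalyticGen, semianalyticGen, mem_setOf_eq,
    contMDiffOn_model_omega_iff_analyticOnNhd hU]

/-- **On a real normed space the manifold notion of subanalytic set is the vector-space one.** [folklore] -/
theorem isManifoldSubanalytic_model_iff {A : Set E} :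
    IsManifoldSubanalytic 𝓘(ℝ, E) A ↔ IsSubanalytic A := by
  refine IsLocallyInBooleanClosure.congr_gen fun U _ => ?_
  ext s
  simp only [manifoldSubanalyticGen, subanalyticGen, mem_setOf_eq]
  constructor
  · rintro ⟨m, B, f, hB, hBb, hf, rfl⟩
    refine ⟨m, B, f, hB, hBb, fun z _ => ?_, rfl⟩
    exact (contMDiff_iff_contDiff.1 hf).contDiffAt.analyticAt
  · rintro ⟨m, B, f, hB, hBb, hf, rfl⟩
    refine ⟨m, B, f, hB, hBb, ?_, rfl⟩
    exact contMDiff_iff_contDiff.2 (contDiff_omega_iff_analyticOnNhd.2 hf)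

end Consistency

end Literature.Geometry.Manifold

end
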